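import Summits.BirchSwinnertonDyer.BirchSwinnertonDyer.Theses.FrozenTwin

/-!
# Line `birth` (BC3 skeleton) for crux `FrozenTwin.GrossMomentSharpness`
# (stmt-BirchSwinnertonDyer-17172, route `route-BirchSwinnertonDyer-FrozenTwin`, crux rank 2)

Registered by the skeleton registrar `planner-skel-stmt-BirchSwinnertonDyer-17172-0` (2026-08-17).

## The crux (recall)

`GrossMomentSharpness` (CERTIFICATE EXISTENCE, both signs): for every elliptic `V/ℚ` (globally minimal)
with a prime of multiplicative reduction there is an ADMISSIBLE DATUM — a prime `p ≥ 5` (good, ordinary,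
`ρ̄_{V,p}` surjective, `p ∤ q² − 1` for `q ∣ N`, `p ∤ v_q(j)` at multiplicative `q`), a definite
factorisation `N = N⁺N⁻` (`N⁻` squarefree with an odd number of primes), the definite quaternion algebra
`(a,b)_ℚ` ramified exactly at `N⁻`, an Eichler order `O` of level `N⁺`, its invertible right ideals `RI`, an
integral `B^×`-invariant Hecke eigenfunction `φ` on `RI` (`T_q φ = a_q(V) φ` for `q ∤ N`, `φ ≢ 0 mod p`), an
imaginary quadratic `K` (`N⁺` split, `N⁻` inert, `(d_K, Np) = 1`, `d_K < −4`) with a conductor-1 Gross point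
`(ψ, I)`, representatives `rep` of `Cl_K` and cyclic non-trivial `p`-Sylow data `(m, σ, dlog)` — together with
an index `k ≤ r_an(V)`, `k + 2 ≤ p`, whose binomial Gross moment `M_k = Σ_𝔞 C(dlog 𝔞, k) · φ(ψ(rep 𝔞) I)` is
prime to `p` (equivalently `v_𝔓(S_χ) ≤ r_an(V)` for the class-group twist `S_χ = Σ_k (−π)^k M_k`).

## The cut (verbatim)

The crux's matrix is cut VERBATIM (so that `GrossMomentSharpness_of` is pure logic) into five named pieces,
sorted by what they depend on:

* `PrimeAdm V p` — the six conditions on the prime (conjunct 1);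
* `Package V N⁺ N⁻ a b O RI` — the `p`-FREE and `K`-FREE quaternionic package: `N = N⁺N⁻` coprime, `N⁻`
  squarefree with an odd number of primes, `a, b < 0`, ramified exactly at `N⁻`, `O` Eichler of level `N⁺`,
  `RI` = the invertible right `O`-ideals (in the adelic-free vocabulary of
  `Literature/NumberTheory/Automorphic/BrandtDefiniteSetupLite.lean`: `Brandt.IsRamifiedExactlyAtLite a b N⁻`,
  `Brandt.IsEichlerOrderLite O N⁺`, `J ∈ RI ↔ J ∈ Brandt.rightIdealsLite O` — stated inline here, as in the
  route file, so that nothing needs unfolding);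
* `HeckeVector V O RI φ` — `φ` is `B^×`-invariant on `RI`, a `T_q`-eigenfunction with eigenvalue `a_q(V)` for
  every prime `q ∤ N`, and PRIMITIVE: for every prime `ℓ` some value on `RI` is prime to `ℓ` (the crux asks this
  only at `ℓ = p`; by Jacquet–Langlands + strong multiplicity one `φ|_RI = ±φ_V` is then canonical);
* `FieldDatum V p N⁺ N⁻ RI K ψ I rep m σ dlog` — everything about the field: `[K:ℚ] = 2`, totally complex,
  `d_K < −4`, `(d_K, Np) = 1`, `N⁺`-primes split, `N⁻`-primes inert, `(ψ, I)` a conductor-1 Gross point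
  (`Brandt.IsGrossPointLite O ψ I` + `Pic(O_K)`-orbit `ψ(rep 𝔞) I ∈ RI`), and the cyclic `p`-Sylow data;
* `Sharp V p K ψ I φ rep dlog` — `∃ k ≤ r_an(V), k + 2 ≤ p, p ∤ M_k` with `moment … k = M_k` verbatim.

## The line: supply ⟂ sharpness, separated along the FREE prime `p`; sharpness split by SIGN

The crux welds a SUPPLY problem (admissible primes; the quaternionic / Jacquet–Langlands package; imaginary
quadratic fields with prescribed splitting and cyclic non-trivial `p`-part of `Cl_K` carrying a Gross point)
to the genuinely open HORIZONTAL mod-`p` NON-VANISHING of one Gross moment (the route review FT-review.md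
flagged exactly this folding). The prime `p` is free in the crux, so the skeleton asks supply cofinally /
eventually in `p` and sharpness eventually in `p`, and the composition picks ONE large admissible prime:

* **A · `stub_admissiblePrimes`** (THEOREM in print; size M given one named fact): admissible primes are
  cofinal. Multiplicative reduction ⇒ `j ∉ ℤ` ⇒ no CM (`not_hasCM_of_hasMultiplicativeReductionAtPrime'`);
  Serre 1972 §4.2 Thm 2 (named fact `serre_open_image`) ⇒ `ρ̄_{V,p}` surjective for `p ≫ 0`; good ordinary
  primes are infinite (`infinite_goodOrdinaryPrimes_holds`, PROVED); `p ∤ q² − 1` (`q ∣ N`) and `p ∤ v_q(j)`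
  exclude finitely many `p`.
* **B1 · `stub_heckePackage`** (THEOREM in print — Hilbert reciprocity, Eichler orders, modularity of `V` (BCDT 2001;
  tree fact `exists_isNewformOf`) + Eichler's basis problem / Jacquet–Langlands with strong multiplicity one; size
  L–XL to formalise): a `V` with a multiplicative prime
  `q₀` admits a package with `N⁻ = q₀` (so `q₀ ∥ N`, `N⁺ = N/q₀` coprime, one prime = odd count; `π_{q₀}`
  Steinberg, so `f_V` transfers) and a primitive integral Hecke eigenfunction `φ` on its class set. Tree
  support: `exists_isTotallyDefinite_ramifiedPlaces_eq`, `exists_isQuaternionAlgebra_of_even_rat`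
  (quaternion algebra of prescribed ramification, PROVED), `Brandt.exists_eigenLattice_eq_span_of_finrank_
  eigenSpace_eq_one` (multiplicity one ⇒ primitive integral eigen-line, PROVED); Eichler orders of level
  `N⁺ > 1` and the JL dictionary are named facts / not yet vendored (`nonempty_eichlerPackage`, `BrandtModule.lean`).
* **B2 · `stub_fieldSupply`** (SUPPLY; theorems in print except ONE Cohen–Lenstra-type coupling; size L): for
  every package, at every sufficiently large admissible `p`, admissible field data of UNBOUNDED discriminant
  exist: imaginary quadratic `K` with `N⁻`-primes inert, `N⁺`-primes split, `(d_K, Np) = 1`, `d_K < −4`,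
  `p ∣ h_K` (divisibility of class numbers with congruence conditions: Nagell / Ankeny–Chowla constructions,
  Soundararajan 2000) with CYCLIC `p`-Sylow (`p ∥ h_K` suffices — the coupling of cyclicity with the local
  conditions is the point not verbatim in print; `p` is large and free), a conductor-1 optimal embedding of
  `O_K` into the left order of some `I ∈ RI` (Eichler's embedding theorem: `N⁻` inert, `N⁺` split; tree:
  `BrandtTraceOptimalEmbeddings`, `EichlerEmbeddingLocalGlobal`) and its `Pic(O_K)`-orbit in `RI`.
* **C⁺ · `stub_sharpEvenSign`** (the OPEN core, even sign; research-sized): for `V` of EVEN analytic rank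
  (`w(V) = +1` by the functional equation; parity of `V.analyticRank` is used so that no root-number notion is
  needed) and EVERY package with its Hecke vector, at every sufficiently large admissible `p` at which
  admissible field data are in unbounded supply, SOME admissible field datum is sharp. Expected mechanism (not
  part of the skeleton): fields with `L(V^{D_K}, 1)` a `p`-unit (`s⁻ = 0`); the definite theta element
  `θ_{V,K} ∈ ℤ[Cl_K]` has order exactly `r_an(V)` in the augmentation filtration of the `p`-Sylow direction for
  a positive proportion of admissible `K` (Bertolini–Darmon 1996 Conj. 4.1-type sharpness in the CLASS-GROUP
  direction; equidistribution of Gross points — Michel 2004, Cornut–Vatsal 2007 — as the engine). Data: kit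
  j010059 (card), 389a1, ten fields, `[M_0, M_1, M_2] ≡ [0, 0, ≢ 0]` in 10/10. Why it might fail: the crux's
  own risk (accidental zeros pushing `θ_K` deeper for every admissible `K`).
* **C⁻ · `stub_sharpOddSign`** (the OPEN core, odd sign; research-sized, numerically UNTESTED): the same at
  ODD analytic rank, where `ε(V^{D_K}) = ε(V) = −1` in the definite setting, `M_0 = 0` identically, and
  sharpness needs `K` with `s_p(V^{D_K}) = 1 ≤ r_an(V)`; first tests in the route's compute protocol: 37a1
  (`M_1 ≢ 0` for some `K`) and 5077a1 (`M_3 ≢ 0`). This is the route header's foreseen layer-2 split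
  `GrossMomentSharpness ⇐ EvenSign → OddSign`.

`GrossMomentSharpness_of` is sorry-free logic over the verbatim cut: a package and its vector from B1,
thresholds from B2 and C^± (by parity of `r_an(V)`), one admissible prime above both from A, the unbounded
family from B2, a sharp field datum from C^±, primitivity of `φ` at `p`, reassembled into the crux's `∃`.

Honest sizes: A known (M); B1 known (L–XL, partly vendored under `Literature/NumberTheory/Automorphic/Brandt*`,
`Quaternion*`); B2 known modulo the cyclicity coupling (L); C⁺, C⁻ research, C⁺ first. Disproof.lean: none
exists for this crux (`ledger crux ls`: no workfiles before this one) — no `_false_without_` obstruction to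
honour; negatives index of the summit: one refuted statement (LeadingTerm TamePinch: CM curves have no
admissible `p`) — not an instance: every stub assumes a multiplicative prime, which CM curves lack.

BC3 probes (planner folder `bc/probe.lean`, 2026-08-17): for each of the five stubs `S`, both
`S → GrossMomentSharpness` and `S → BirchSwinnertonDyer` by `first | exact? | simpa | aesop` FAIL.
-/

set_option linter.unusedVariables false
set_option linter.dupNamespace false

noncomputable section

namespace Summit.BirchSwinnertonDyer.BirchSwinnertonDyer.Cruxes.GrossMomentSharpness.Birth

open scoped BigOperators Classical
open Summit.BirchSwinnertonDyer.BirchSwinnertonDyer.Theses.FrozenTwin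
open Literature

/-! ## The crux's matrix, cut verbatim into named pieces -/

/-- `PrimeAdm V p`: the six admissibility conditions on the certificate prime (conjunct 1 of the crux's
datum, verbatim): `p ≥ 5`, good reduction, ordinary (`p ∤ a_p`), `ρ̄_{V,p}` surjective, `p ∤ q² − 1` for
every prime `q ∣ N_V`, and `p ∤ v_q(j(V))` at every multiplicative prime `q`. -/
def PrimeAdm (V : WeierstrassCurve ℚ) [V.IsElliptic] [V.IsGloballyMinimal] (p : ℕ) [Fact p.Prime] : Prop :=
  5 ≤ p ∧ V.HasGoodReductionAtPrime p ∧ ¬ (p : ℤ) ∣ V.frobeniusTrace p ∧ V.HasSurjectiveModNGaloisRep p ∧ (∀ q : ℕ, q.Prime → q ∣ V.conductorNorm ℤ → ¬ (p : ℤ) ∣ (q : ℤ) ^ 2 - 1) ∧ (∀ (q : ℕ) (_ : Fact q.Prime), V.HasMultiplicativeReductionAtPrime q → ¬ (p : ℤ) ∣ padicValRat q V.j)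

/-- `Package V N⁺ N⁻ a b O RI`: the `p`-free, `K`-free quaternionic package (verbatim conjuncts of the crux):
`N_V = N⁺N⁻` coprime with `N⁻` squarefree and an odd number of prime factors; `a, b < 0` and `(a,b)_ℚ`
ramified exactly at the primes of `N⁻` (`Brandt.IsRamifiedExactlyAtLite a b N⁻`); `O = O₁ ⊓ O₂` an Eichler
order of level `N⁺` (`Brandt.IsEichlerOrderLite O N⁺`); `RI` the set of invertible right `O`-ideals
(`J ∈ RI ↔ J ∈ Brandt.rightIdealsLite O`). -/
def Package (V : WeierstrassCurve ℚ) [V.IsElliptic] [V.IsGloballyMinimal] (Nplus Nminus : ℕ) (a b : ℚ)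
    (O : Subring (QuaternionAlgebra ℚ a 0 b)) (RI : Set (Submodule ℤ (QuaternionAlgebra ℚ a 0 b))) : Prop :=
  (V.conductorNorm ℤ = Nplus * Nminus ∧ Nat.Coprime Nplus Nminus ∧ Squarefree Nminus ∧ Odd Nminus.primeFactors.card) ∧ (a < 0 ∧ b < 0 ∧ (∀ (q : ℕ) [Fact q.Prime], (∀ x : QuaternionAlgebra ℚ_[q] (a : ℚ_[q]) 0 (b : ℚ_[q]), x ≠ 0 → IsUnit x) ↔ q ∣ Nminus)) ∧ (∃ O₁ O₂ : Subring (QuaternionAlgebra ℚ a 0 b), (∀ S : Subring (QuaternionAlgebra ℚ a 0 b), (S = O₁ ∨ S = O₂) → (S.toAddSubgroup.FG ∧ (∀ d : QuaternionAlgebra ℚ a 0 b, ∃ n : ℤ, n ≠ 0 ∧ n • d ∈ S) ∧ ∀ S' : Subring (QuaternionAlgebra ℚ a 0 b), S'.toAddSubgroup.FG → S ≤ S' → S' = S)) ∧ O = O₁ ⊓ O₂ ∧ O.toAddSubgroup.relIndex O₁.toAddSubgroup = Nplus) ∧ (∀ J : Submodule ℤ (QuaternionAlgebra ℚ a 0 b),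 J ∈ RI ↔ (J.FG ∧ (∀ d : QuaternionAlgebra ℚ a 0 b, ∃ n : ℤ, n ≠ 0 ∧ n • d ∈ J) ∧ (∀ x : QuaternionAlgebra ℚ a 0 b, (∀ y ∈ J, y * x ∈ J) ↔ x ∈ O) ∧ (∃ J' : Submodule ℤ (QuaternionAlgebra ℚ a 0 b), (∀ x : QuaternionAlgebra ℚ a 0 b, x ∈ J * J' ↔ ∀ y ∈ J, x * y ∈ J) ∧ (∀ x : QuaternionAlgebra ℚ a 0 b, x ∈ J' * J ↔ x ∈ O))))

/-- `HeckeVector V O RI φ`: `φ` is invariant under left multiplication by `B^×` on `RI`, satisfies the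
Brandt–Hecke eigen-equations `Σ_{J' ∈ T_q(J)} φ J' = a_q(V) φ J` for every prime `q ∤ N_V` and `J ∈ RI`
(`T_q(J)` = right-`O`-stable sublattices of index `q²`, `Brandt.heckeNeighboursLite O q J`), and is PRIMITIVE:
for every prime `ℓ` some value on `RI` is prime to `ℓ` (the crux's `∃ J ∈ RI, p ∤ φ J`, asked at every `ℓ`). -/
def HeckeVector (V : WeierstrassCurve ℚ) [V.IsElliptic] [V.IsGloballyMinimal] {a b : ℚ}
    (O : Subring (QuaternionAlgebra ℚ a 0 b)) (RI : Set (Submodule ℤ (QuaternionAlgebra ℚ a 0 b)))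
    (φ : Submodule ℤ (QuaternionAlgebra ℚ a 0 b) → ℤ) : Prop :=
  (∀ J ∈ RI, ∀ β : QuaternionAlgebra ℚ a 0 b, IsUnit β → φ (J.map (AddMonoidHom.mulLeft β).toIntLinearMap) = φ J) ∧ (∀ q : ℕ, q.Prime → ¬ q ∣ V.conductorNorm ℤ → ∀ J ∈ RI, ∑ᶠ J' ∈ {J' : Submodule ℤ (QuaternionAlgebra ℚ a 0 b) | J' ≤ J ∧ J'.toAddSubgroup.relIndex J.toAddSubgroup = q ^ 2 ∧ ∀ y ∈ J', ∀ x ∈ O, y * x ∈ J'}, φ J' = (V.frobeniusTrace q : ℤ) * φ J) ∧ (∀ ℓ : ℕ, ℓ.Prime → ∃ J ∈ RI, ¬ (ℓ : ℤ) ∣ φ J)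

/-- `FieldDatum V p N⁺ N⁻ RI K ψ I rep m σ dlog`: everything the crux asks of the field (verbatim conjuncts):
`[K:ℚ] = 2`, totally complex, `d_K < −4`, `gcd(d_K, N_V p) = 1`; every prime of `N⁺` splits and every prime
of `N⁻` is inert in `K`; `(ψ, I)` is a conductor-1 Gross point (`I ∈ RI`, `ψ(O_K) I ⊆ I` optimally —
`Brandt.IsGrossPointLite O ψ I`), `rep` picks representatives of `Cl_K` and the orbit `ψ(rep 𝔞) I` stays in
`RI`; `σ` generates the (cyclic, non-trivial) `p`-Sylow of `Cl_K`, of order `p^m`, with discrete logarithm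
`dlog`. -/
def FieldDatum (V : WeierstrassCurve ℚ) [V.IsElliptic] [V.IsGloballyMinimal] (p Nplus Nminus : ℕ)
    {a b : ℚ} (RI : Set (Submodule ℤ (QuaternionAlgebra ℚ a 0 b))) (K : Type) [Field K] [NumberField K]
    (ψ : K →ₐ[ℚ] QuaternionAlgebra ℚ a 0 b) (I : Submodule ℤ (QuaternionAlgebra ℚ a 0 b))
    (rep : ClassGroup (NumberField.RingOfIntegers K) → nonZeroDivisors (Ideal (NumberField.RingOfIntegers K)))
    (m : ℕ) (σ : ClassGroup (NumberField.RingOfIntegers K))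
    (dlog : ClassGroup (NumberField.RingOfIntegers K) → ℕ) : Prop :=
  (Module.finrank ℚ K = 2 ∧ NumberField.IsTotallyComplex K ∧ NumberField.discr K < -4 ∧ Int.gcd (NumberField.discr K) (V.conductorNorm ℤ * p) = 1) ∧ ((∀ q : ℕ, q.Prime → q ∣ Nplus → ((Ideal.span {(q : ℤ)}).primesOver (NumberField.RingOfIntegers K)).ncard = 2) ∧ (∀ q : ℕ, q.Prime → q ∣ Nminus → ((Ideal.span {(q : ℤ)}).primesOver (NumberField.RingOfIntegers K)).ncard = 1)) ∧ (I ∈ RI ∧ (∀ x : NumberField.RingOfIntegers K, ∀ y ∈ I, ψ (x : K) * y ∈ I) ∧ (∀ x : K, (∀ y ∈ I, ψ x * y ∈ I) → ∃ z : NumberField.RingOfIntegers K, (z : K) = x) ∧ (∀ 𝔞 : ClassGroup (NumberField.RingOfIntegers K), ClassGroup.mk0 (rep 𝔞) = 𝔞) ∧ (∀ 𝔞 : ClassGroup (NumberField.RingOfIntegers K), Submodule.span ℤ ((fun x : NumberField.RingOfIntegers K => ψ (x : K)) '' ((rep 𝔞 : nonZeroDivisors (Ideal (NumberField.RingOfIntegers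 K))) : Ideal (NumberField.RingOfIntegers K))) * I ∈ RI)) ∧ (1 ≤ m ∧ orderOf σ = p ^ m ∧ ¬ p ^ (m + 1) ∣ Fintype.card (ClassGroup (NumberField.RingOfIntegers K)) ∧ (∀ 𝔞 : ClassGroup (NumberField.RingOfIntegers K), dlog 𝔞 < p ^ m ∧ Nat.Coprime (orderOf (𝔞 * (σ ^ dlog 𝔞)⁻¹)) p))

/-- `moment K ψ I φ rep dlog k = M_k = Σ_{𝔞 ∈ Cl_K} C(dlog 𝔞, k) · φ(ψ(rep 𝔞) · I)`: the `k`-th binomial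
Gross moment (the crux's sum, verbatim). -/
def moment (K : Type) [Field K] [NumberField K] {a b : ℚ} (ψ : K →ₐ[ℚ] QuaternionAlgebra ℚ a 0 b)
    (I : Submodule ℤ (QuaternionAlgebra ℚ a 0 b)) (φ : Submodule ℤ (QuaternionAlgebra ℚ a 0 b) → ℤ)
    (rep : ClassGroup (NumberField.RingOfIntegers K) → nonZeroDivisors (Ideal (NumberField.RingOfIntegers K)))
    (dlog : ClassGroup (NumberField.RingOfIntegers K) → ℕ) (k : ℕ) : ℤ :=
  ∑ 𝔞 : ClassGroup (NumberField.RingOfIntegers K), ((dlog 𝔞).choose k : ℤ) * φ (Submodule.span ℤ ((fun x : NumberField.RingOfIntegers K => ψ (x : K)) '' ((rep 𝔞 : nonZeroDivisors (Ideal (NumberField.RingOfIntegers K))) : Ideal (NumberField.RingOfIntegers K))) * I)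

/-- `Sharp V p K ψ I φ rep dlog`: the crux's conclusion on a datum, verbatim — some moment of index
`k ≤ r_an(V)`, `k + 2 ≤ p`, is prime to `p` (i.e. `v_𝔓(S_χ) = min{k : p ∤ M_k} ≤ r_an(V)`). -/
def Sharp (V : WeierstrassCurve ℚ) [V.IsElliptic] (p : ℕ) (K : Type) [Field K] [NumberField K] {a b : ℚ}
    (ψ : K →ₐ[ℚ] QuaternionAlgebra ℚ a 0 b) (I : Submodule ℤ (QuaternionAlgebra ℚ a 0 b))
    (φ : Submodule ℤ (QuaternionAlgebra ℚ a 0 b) → ℤ)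
    (rep : ClassGroup (NumberField.RingOfIntegers K) → nonZeroDivisors (Ideal (NumberField.RingOfIntegers K)))
    (dlog : ClassGroup (NumberField.RingOfIntegers K) → ℕ) : Prop :=
  ∃ k : ℕ, k ≤ V.analyticRank ∧ k + 2 ≤ p ∧ ¬ (p : ℤ) ∣ moment K ψ I φ rep dlog k

/-! ## Registered stubs -/

/-- **A · `stub_admissiblePrimes` — admissible primes are cofinal (THEOREM in print: no CM because of the
multiplicative prime; Serre 1972 §4.2 Thm 2 = named fact `serre_open_image`; infinitely many good ordinary
primes = `infinite_goodOrdinaryPrimes_holds` (proved); finitely many exclusions from `p ∤ q² − 1`, `q ∣ N`,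
and `p ∤ v_q(j)`).** [cite: Serre1972, §4.2 Thm 2] [cite: Serre1981, §8 Cor. 2] -/
theorem stub_admissiblePrimes :
    ∀ (V : WeierstrassCurve ℚ) [V.IsElliptic] [V.IsGloballyMinimal],
      (∃ (q : ℕ) (_ : Fact q.Prime), V.HasMultiplicativeReductionAtPrime q) →
      ∀ n : ℕ, ∃ (p : ℕ) (_ : Fact p.Prime), n ≤ p ∧ PrimeAdm V p := by
  sorry

/-- **B1 · `stub_heckePackage` — the quaternionic package and its primitive Hecke vector exist (THEOREM in
print: definite quaternion algebra ramified exactly at one multiplicative prime `q₀` and `∞` — Hilbert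
reciprocity; an Eichler order of level `N/q₀` and its invertible right ideals; the integral, primitive
Jacquet–Langlands / Eichler eigenvector with `T_q`-eigenvalues `a_q(V)`, `q ∤ N`, of the newform `f_V` attached
to `V` by modularity (tree fact `exists_isNewformOf`), unique up to sign by strong multiplicity one since `f_V` is
new of level `N = N⁺N⁻` and Steinberg at `q₀`).** [cite: BreuilConradDiamondTaylor2001, Thm. A]
[cite: VignerasLNM800, Ch. III §3 Thm. 3.1] [cite: Eichler1955, Satz 1 (basis problem)]
[cite: Gross1987, §§1–5] [cite: JacquetLanglands1970, Thm. 14.4 / 16.1] -/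
theorem stub_heckePackage :
    ∀ (V : WeierstrassCurve ℚ) [V.IsElliptic] [V.IsGloballyMinimal],
      (∃ (q : ℕ) (_ : Fact q.Prime), V.HasMultiplicativeReductionAtPrime q) →
      ∃ (Nplus Nminus : ℕ) (a b : ℚ) (O : Subring (QuaternionAlgebra ℚ a 0 b)) (RI : Set (Submodule ℤ (QuaternionAlgebra ℚ a 0 b))) (φ : Submodule ℤ (QuaternionAlgebra ℚ a 0 b) → ℤ), Package V Nplus Nminus a b O RI ∧ HeckeVector V O RI φ := by
  sorry

/-- **B2 · `stub_fieldSupply` — admissible field data are in unbounded supply at every large admissible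
prime (SUPPLY: imaginary quadratic `K` with the `N⁻`-primes inert, the `N⁺`-primes split, `(d_K, Np) = 1`,
`d_K < −4`, `p ∣ h_K` with CYCLIC `p`-Sylow, a conductor-1 optimal embedding of `O_K` into the left order of
some `I ∈ RI` — Eichler's embedding theorem — and its `Pic(O_K)`-orbit in `RI`; of arbitrarily large `|d_K|`).**
Theorems in print except the coupling "cyclic non-trivial `p`-part of `Cl_K` + prescribed splitting" for all
large `p` (Cohen–Lenstra-generic; `p ∥ h_K` suffices). [cite: Gross1987, §3] [cite: Eichler1955, Satz 7]
[cite: Soundararajan2000, Thm. 1] [cite: AnkenyChowla1955, Thm. 1] [cite: CohenLenstra1984, §9] -/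
theorem stub_fieldSupply :
    ∀ (V : WeierstrassCurve ℚ) [V.IsElliptic] [V.IsGloballyMinimal],
      (∃ (q : ℕ) (_ : Fact q.Prime), V.HasMultiplicativeReductionAtPrime q) →
      ∀ (Nplus Nminus : ℕ) (a b : ℚ) (O : Subring (QuaternionAlgebra ℚ a 0 b)) (RI : Set (Submodule ℤ (QuaternionAlgebra ℚ a 0 b))), Package V Nplus Nminus a b O RI →
        ∃ n₀ : ℕ, ∀ (p : ℕ) (_ : Fact p.Prime), n₀ ≤ p → PrimeAdm V p →
          ∀ X : ℕ, ∃ (K : Type) (_ : Field K) (_ : NumberField K) (ψ : K →ₐ[ℚ] QuaternionAlgebra ℚ a 0 b) (I : Submodule ℤ (QuaternionAlgebra ℚ a 0 b)) (rep : ClassGroup (NumberField.RingOfIntegers K) → nonZeroDivisors (Ideal (NumberField.RingOfIntegers K))) (m : ℕ) (σ : ClassGroup (NumberField.RingOfIntegers K)) (dlog : ClassGroup (NumberField.RingOfIntegers K) → ℕ), X < (NumberField.discr K).natAbs ∧ FieldDatum V p Nplus Nminus RI K ψ I rep m σ dlog := by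
  sorry

/-- **C⁺ · `stub_sharpEvenSign` — the OPEN core at even sign: for `V` of even analytic rank and every
package with its Hecke vector, at every sufficiently large admissible prime `p` at which admissible field
data are in unbounded supply, SOME admissible field datum has a Gross moment `M_k`, `k ≤ r_an(V)`,
`k ≤ p − 2`, prime to `p` (horizontal mod-`p` sharpness of the definite theta element in the class-group
direction; twin field with `L(V^{D_K},1)` a `p`-unit).** Why it might fail: the crux's own risk.
[cite: BertoliniDarmon1996, Conj. 4.1] [cite: Gross1987, §11 Prop. 11.2] [cite: Michel2004, Thm. 10]
[cite: CornutVatsal2007, Thm. 1.5] -/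
theorem stub_sharpEvenSign :
    ∀ (V : WeierstrassCurve ℚ) [V.IsElliptic] [V.IsGloballyMinimal],
      (∃ (q : ℕ) (_ : Fact q.Prime), V.HasMultiplicativeReductionAtPrime q) →
      Even V.analyticRank →
      ∀ (Nplus Nminus : ℕ) (a b : ℚ) (O : Subring (QuaternionAlgebra ℚ a 0 b)) (RI : Set (Submodule ℤ (QuaternionAlgebra ℚ a 0 b))) (φ : Submodule ℤ (QuaternionAlgebra ℚ a 0 b) → ℤ), Package V Nplus Nminus a b O RI → HeckeVector V O RI φ →
        ∃ n₀ : ℕ, ∀ (p : ℕ) (_ : Fact p.Prime), n₀ ≤ p → PrimeAdm V p →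
          (∀ X : ℕ, ∃ (K : Type) (_ : Field K) (_ : NumberField K) (ψ : K →ₐ[ℚ] QuaternionAlgebra ℚ a 0 b) (I : Submodule ℤ (QuaternionAlgebra ℚ a 0 b)) (rep : ClassGroup (NumberField.RingOfIntegers K) → nonZeroDivisors (Ideal (NumberField.RingOfIntegers K))) (m : ℕ) (σ : ClassGroup (NumberField.RingOfIntegers K)) (dlog : ClassGroup (NumberField.RingOfIntegers K) → ℕ), X < (NumberField.discr K).natAbs ∧ FieldDatum V p Nplus Nminus RI K ψ I rep m σ dlog) →
          ∃ (K : Type) (_ : Field K) (_ : NumberField K) (ψ : K →ₐ[ℚ] QuaternionAlgebra ℚ a 0 b) (I : Submodule ℤ (QuaternionAlgebra ℚ a 0 b)) (rep : ClassGroup (NumberField.RingOfIntegers K) → nonZeroDivisors (Ideal (NumberField.RingOfIntegers K))) (m : ℕ) (σ : ClassGroup (NumberField.RingOfIntegers K)) (dlog : ClassGroup (NumberField.RingOfIntegers K) → ℕ), FieldDatum V p Nplus Nminus RI K ψ I rep m σ dlog ∧ Sharp V p K ψ I φ rep dlog := by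
  sorry

/-- **C⁻ · `stub_sharpOddSign` — the OPEN core at odd sign (numerically untested): the same for `V` of odd
analytic rank, where `ε(V^{D_K}) = ε(V) = −1` in the definite setting, `M_0 = 0`, and sharpness needs a
field with `s_p(V^{D_K}) = 1 ≤ r_an(V)`.** [cite: BertoliniDarmon1996, Conj. 4.1] [cite: Gross1987, §11]
[cite: MazurRubin2007, Thm. 1.4] -/
theorem stub_sharpOddSign :
    ∀ (V : WeierstrassCurve ℚ) [V.IsElliptic] [V.IsGloballyMinimal],
      (∃ (q : ℕ) (_ : Fact q.Prime), V.HasMultiplicativeReductionAtPrime q) →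
      Odd V.analyticRank →
      ∀ (Nplus Nminus : ℕ) (a b : ℚ) (O : Subring (QuaternionAlgebra ℚ a 0 b)) (RI : Set (Submodule ℤ (QuaternionAlgebra ℚ a 0 b))) (φ : Submodule ℤ (QuaternionAlgebra ℚ a 0 b) → ℤ), Package V Nplus Nminus a b O RI → HeckeVector V O RI φ →
        ∃ n₀ : ℕ, ∀ (p : ℕ) (_ : Fact p.Prime), n₀ ≤ p → PrimeAdm V p →
          (∀ X : ℕ, ∃ (K : Type) (_ : Field K) (_ : NumberField K) (ψ : K →ₐ[ℚ] QuaternionAlgebra ℚ a 0 b) (I : Submodule ℤ (QuaternionAlgebra ℚ a 0 b)) (rep : ClassGroup (NumberField.RingOfIntegers K) → nonZeroDivisors (Ideal (NumberField.RingOfIntegers K))) (m : ℕ) (σ : ClassGroup (NumberField.RingOfIntegers K)) (dlog : ClassGroup (NumberField.RingOfIntegers K) → ℕ), X < (NumberField.discr K).natAbs ∧ FieldDatum V p Nplus Nminus RI K ψ I rep m σ dlog) →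
          ∃ (K : Type) (_ : Field K) (_ : NumberField K) (ψ : K →ₐ[ℚ] QuaternionAlgebra ℚ a 0 b) (I : Submodule ℤ (QuaternionAlgebra ℚ a 0 b)) (rep : ClassGroup (NumberField.RingOfIntegers K) → nonZeroDivisors (Ideal (NumberField.RingOfIntegers K))) (m : ℕ) (σ : ClassGroup (NumberField.RingOfIntegers K)) (dlog : ClassGroup (NumberField.RingOfIntegers K) → ℕ), FieldDatum V p Nplus Nminus RI K ψ I rep m σ dlog ∧ Sharp V p K ψ I φ rep dlog := by
  sorry

/-! ## Stub statements by name -/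

namespace Statement

/-- Statement of `stub_admissiblePrimes`. -/
abbrev stub_admissiblePrimes : Prop := type_of% @Birth.stub_admissiblePrimes
/-- Statement of `stub_heckePackage`. -/
abbrev stub_heckePackage : Prop := type_of% @Birth.stub_heckePackage
/-- Statement of `stub_fieldSupply`. -/
abbrev stub_fieldSupply : Prop := type_of% @Birth.stub_fieldSupply
/-- Statement of `stub_sharpEvenSign`. -/
abbrev stub_sharpEvenSign : Prop := type_of% @Birth.stub_sharpEvenSign
/-- Statement of `stub_sharpOddSign`. -/
abbrev stub_sharpOddSign : Prop := type_of% @Birth.stub_sharpOddSign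

end Statement

/-! ## The composition (sorry-free) -/

/-- The sharpness stubs of the two signs combine to sharpness at every parity of `r_an(V)`. -/
theorem sharp_of_signs (hCe : Statement.stub_sharpEvenSign) (hCo : Statement.stub_sharpOddSign) :
    ∀ (V : WeierstrassCurve ℚ) [V.IsElliptic] [V.IsGloballyMinimal],
      (∃ (q : ℕ) (_ : Fact q.Prime), V.HasMultiplicativeReductionAtPrime q) →
      ∀ (Nplus Nminus : ℕ) (a b : ℚ) (O : Subring (QuaternionAlgebra ℚ a 0 b)) (RI : Set (Submodule ℤ (QuaternionAlgebra ℚ a 0 b))) (φ : Submodule ℤ (QuaternionAlgebra ℚ a 0 b) → ℤ), Package V Nplus Nminus a b O RI → HeckeVector V O RI φ →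
        ∃ n₀ : ℕ, ∀ (p : ℕ) (_ : Fact p.Prime), n₀ ≤ p → PrimeAdm V p →
          (∀ X : ℕ, ∃ (K : Type) (_ : Field K) (_ : NumberField K) (ψ : K →ₐ[ℚ] QuaternionAlgebra ℚ a 0 b) (I : Submodule ℤ (QuaternionAlgebra ℚ a 0 b)) (rep : ClassGroup (NumberField.RingOfIntegers K) → nonZeroDivisors (Ideal (NumberField.RingOfIntegers K))) (m : ℕ) (σ : ClassGroup (NumberField.RingOfIntegers K)) (dlog : ClassGroup (NumberField.RingOfIntegers K) → ℕ), X < (NumberField.discr K).natAbs ∧ FieldDatum V p Nplus Nminus RI K ψ I rep m σ dlog) →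
          ∃ (K : Type) (_ : Field K) (_ : NumberField K) (ψ : K →ₐ[ℚ] QuaternionAlgebra ℚ a 0 b) (I : Submodule ℤ (QuaternionAlgebra ℚ a 0 b)) (rep : ClassGroup (NumberField.RingOfIntegers K) → nonZeroDivisors (Ideal (NumberField.RingOfIntegers K))) (m : ℕ) (σ : ClassGroup (NumberField.RingOfIntegers K)) (dlog : ClassGroup (NumberField.RingOfIntegers K) → ℕ), FieldDatum V p Nplus Nminus RI K ψ I rep m σ dlog ∧ Sharp V p K ψ I φ rep dlog := by
  intro V _ _ hm
  rcases Nat.even_or_odd V.analyticRank with he | ho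
  · exact hCe V hm he
  · exact hCo V hm ho

/-- **`GrossMomentSharpness_of`** — the five stub STATEMENTS imply the crux, BY NAME. Pure logic over the
verbatim cut: a package and its Hecke vector (B1), thresholds from B2 and C^±, one admissible prime above
both (A), the unbounded admissible family at that prime (B2), a sharp admissible field datum (C^±), the
primitivity of `φ` at `p`, reassembled in the crux's order. -/
theorem GrossMomentSharpness_of (hA : Statement.stub_admissiblePrimes) (hB1 : Statement.stub_heckePackage)
    (hB2 : Statement.stub_fieldSupply) (hCe : Statement.stub_sharpEvenSign)
    (hCo : Statement.stub_sharpOddSign) : GrossMomentSharpness := by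
  intro V _ _ hm
  obtain ⟨Nplus, Nminus, a, b, O, RI, φ, hP, hH⟩ := hB1 V hm
  obtain ⟨nB, hnB⟩ := hB2 V hm Nplus Nminus a b O RI hP
  obtain ⟨nC, hnC⟩ := sharp_of_signs hCe hCo V hm Nplus Nminus a b O RI φ hP hH
  obtain ⟨p, hp, hnp, hadm⟩ := hA V hm (max nB nC)
  have hfam := hnB p hp ((le_max_left nB nC).trans hnp) hadm
  obtain ⟨K, hFK, hNK, ψ, I, rep, m, σ, dlog, hF, hS⟩ :=
    hnC p hp ((le_max_right nB nC).trans hnp) hadm hfam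
  obtain ⟨⟨hN, hcop, hsq, hodd⟩, halg, heich, hri⟩ := hP
  obtain ⟨hinv, hhecke, hprim⟩ := hH
  obtain ⟨hfield, ⟨hsplit, hinert⟩, hgross, hsyl⟩ := hF
  obtain ⟨k, hkr, hkp, hndvd⟩ := hS
  obtain ⟨J, hJ, hpJ⟩ := hprim p hp.out
  exact ⟨p, hp, Nplus, Nminus, m, a, b, O, K, hFK, hNK, ψ, I, φ, rep, RI, σ, dlog,
    ⟨hadm, hfield, ⟨hN, hcop, hsq, hodd, hsplit, hinert⟩, halg, heich, hri, ⟨hinv, hhecke, J, hJ, hpJ⟩,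
      hgross, hsyl⟩,
    k, hkr, hkp, hndvd⟩

/-- The crux along this line, MODULO the five registered stubs (sorries live only in `stub_*`). -/
theorem GrossMomentSharpness_proof : GrossMomentSharpness :=
  GrossMomentSharpness_of stub_admissiblePrimes stub_heckePackage stub_fieldSupply stub_sharpEvenSign
    stub_sharpOddSign

end Summit.BirchSwinnertonDyer.BirchSwinnertonDyer.Cruxes.GrossMomentSharpness.Birth

end
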